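import Mathlib

/-!
# Stub `stub_tangencySets` (crux `LevelOneGL2Designs`, stmt-MatrixMultiplication-14080) —
wall-breaker axis 1/12 "Hermitian unital constructions" (gen 1, seat 2), part B: equivariant
tangent fields

Part A (`…HermitianPolarityCap.lean`) showed that designating to each point its polar line under a
SYMMETRIC form (the only "Hermitian" option over `ZMod p`) caps a design at `p + 1`.  The unital has a
second feature besides being polar: its tangent field is equivariant under the unitary group.  The
prime-field avatar of `GU₁(𝔽_{q²}/𝔽_q)` acting on the affine plane is the non-split torus
`𝔽_p[J]ˣ ≅ 𝔽_{p²}ˣ` (`J ∈ M₂(𝔽_p)` without eigenvectors), acting simply transitively on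
`𝔽_p² ∖ 0`; a torus-equivariant tangent field is `x ↦ x + 𝔽_p·(J + c)x`, and more generally an
*affine direction field* is `x ↦ x + 𝔽_p·(J x + k)` (`k = 0`, `J` irreducible: torus fields — circle
tangents when `tr (J + c) = 0`, "spiral" fields otherwise; `k = 0`, `J` split: hyperbola / power-curve
pencils; `J` nilpotent, `k ≠ 0`: the parabola pencils of the parabola-lift axis).  This file proves:

* `affineField_srs` — EXACT transfer: a point set `X ⊆ F² ∖ 0` no point of which lies on the
  designated line `x' + F·(J x' + k)` of another, with `J x + k ∦ x` on `X` (the lines miss the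
  origin), yields a design in the stub's format of size exactly `|X|` with point set `X` (covector
  `(J x + k)^⊥ / det(x, J x + k)`); no origin or chart loss, every field.
* `linearField_equivariant` — for `k = 0` the admissible sets are permuted by every injective `g`
  commuting with `J`: the spoiling relation is invariant under the torus `F[J]ˣ` (for `J`
  irreducible over `𝔽_p`: a Cayley graph on `ℤ/(p²−1)` generated by a translate of a Bose–Chowla
  Sidon set minus `0`; all non-trivial eigenvalues `≤ 2√p` in modulus by Katz's bound, so the
  Hoffman ratio bound is `≈ p^{3/2}` — the ISW bound again).
* `stub_tangencySets_of_affineFields` — the residual in the stub's quantifier shape: admissible sets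
  of size `c·p^{3/2}` for affine direction fields over unboundedly many primes give the stub with the
  SAME constant `c`.

Census (this seat, exact branch-and-bound, `comp/torus_mis2.py`, attached to the item): the
torus-field optimum `max_c α(Γ_{J+c})` is `4, 8, 16, 26` at `p = 3, 5, 7, 11` against the unrestricted
optimum `T(p) = 4, 10, 17, ≥ 33` — the equivariant family is not extremal already at `p = 5`.
Mathlib only; no new definitions.
-/

set_option linter.dupNamespace false

namespace Summit.MatrixMultiplication.MatrixMultiplication.Theorems.LevelOneGL2Designs.HermitianUnital

open Finset Matrix

section TwoDim

variable {F : Type*} [Field F]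

/-- Parallel vectors in `F²`: if `det(a, b) = 0` and `b ≠ 0` then `a` is a multiple of `b`.
[folklore] -/
theorem exists_eq_smul_of_det_eq_zero (a b : Fin 2 → F) (hb : b ≠ 0)
    (h : a 0 * b 1 - a 1 * b 0 = 0) : ∃ t : F, a = t • b := by
  by_cases hb0 : b 0 = 0
  · have hb1 : b 1 ≠ 0 := by
      intro hb1
      apply hb
      funext i
      fin_cases i
      · exact hb0
      · exact hb1
    have ha0 : a 0 = 0 := by
      rw [hb0, mul_zero, sub_zero] at h
      exact (mul_eq_zero.mp h).resolve_right hb1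
    refine ⟨a 1 / b 1, ?_⟩
    funext i
    fin_cases i
    · simp [ha0, hb0]
    · simp [div_mul_cancel₀ _ hb1]
  · refine ⟨a 0 / b 0, ?_⟩
    funext i
    fin_cases i
    · simp [div_mul_cancel₀ _ hb0]
    · simp only [Fin.mk_one, Fin.isValue, Pi.smul_apply, smul_eq_mul]
      field_simp
      linear_combination -h

/-- The `2 × 2` determinant as a dot product with the rotated vector. [folklore] -/
theorem dotProduct_rot (x y : Fin 2 → F) : x ⬝ᵥ ![y 1, -y 0] = x 0 * y 1 - x 1 * y 0 := by
  simp only [dotProduct, Fin.sum_univ_two, cons_val_zero, cons_val_one]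
  ring

end TwoDim

section AffineField

variable {F : Type*} [Field F] [DecidableEq F]

/-- **Exact transfer for affine direction fields.**  Let `J ∈ M₂(F)`, `k ∈ F²`, and
`X ⊆ F² ∖ {0}` such that (i) `J x + k` is never a multiple of `x` on `X` (the designated line
`x + F·(J x + k)` is a line and misses the origin) and (ii) no point of `X` lies on the designated
line of ANOTHER point of `X`.  Then the flags `(x, (J x + k)^⊥ / det(x, J x + k))`, `x ∈ X`, form a
design `S` in the stub's format (`u_f ⬝ v_{f'} = 1 ↔ f = f'`) of size exactly `|X|`, with point set
`X`.  [elementary] -/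
theorem affineField_srs (J : Matrix (Fin 2) (Fin 2) F) (k : Fin 2 → F) (X : Finset (Fin 2 → F))
    (h0 : (0 : Fin 2 → F) ∉ X) (hJ : ∀ x ∈ X, ∀ t : F, J *ᵥ x + k ≠ t • x)
    (hX : ∀ x ∈ X, ∀ x' ∈ X, ∀ t : F, x = x' + t • (J *ᵥ x' + k) → x = x') :
    ∃ S : Finset ((Fin 2 → F) × (Fin 2 → F)), S.card = X.card ∧ (∀ f ∈ S, f.1 ∈ X) ∧
      ∀ f ∈ S, ∀ f' ∈ S, (f.1 ⬝ᵥ f'.2 = 1 ↔ f = f') := by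
  classical
  -- the rotated direction `w x = (J x + k)^⊥` and the normalising determinant `d x = det(x, J x + k)`
  let w : (Fin 2 → F) → (Fin 2 → F) := fun x => ![(J *ᵥ x + k) 1, -(J *ᵥ x + k) 0]
  let d : (Fin 2 → F) → F := fun x => x ⬝ᵥ w x
  have hd : ∀ x y : Fin 2 → F, y ⬝ᵥ w x = y 0 * (J *ᵥ x + k) 1 - y 1 * (J *ᵥ x + k) 0 :=
    fun x y => dotProduct_rot y (J *ᵥ x + k)
  have hx0 : ∀ x ∈ X, x ≠ 0 := fun x hx h => h0 (h ▸ hx)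
  have hdir0 : ∀ x ∈ X, J *ᵥ x + k ≠ 0 := fun x hx h => hJ x hx 0 (by rw [h, zero_smul])
  have hd0 : ∀ x ∈ X, d x ≠ 0 := by
    intro x hx h
    have h' : (J *ᵥ x + k) 0 * x 1 - (J *ᵥ x + k) 1 * x 0 = 0 := by
      have := hd x x
      simp only [d] at h
      rw [h] at this
      linear_combination this
    obtain ⟨t, ht⟩ := exists_eq_smul_of_det_eq_zero _ _ (hx0 x hx) h'
    exact hJ x hx t ht
  -- the flags
  let Φ : (Fin 2 → F) → (Fin 2 → F) × (Fin 2 → F) := fun x => (x, (d x)⁻¹ • w x)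
  have hΦ : Function.Injective Φ := fun x y h => congrArg Prod.fst h
  -- incidence: `x ⬝ v_{x'} = 1 ↔ x = x'`
  have key : ∀ x ∈ X, ∀ x' ∈ X, (x ⬝ᵥ ((d x')⁻¹ • w x') = 1 ↔ x = x') := by
    intro x hx x' hx'
    rw [dotProduct_smul, smul_eq_mul]
    constructor
    · intro h
      have h1 : x ⬝ᵥ w x' = d x' := by
        have := congrArg (fun z => d x' * z) h
        simpa [← mul_assoc, mul_inv_cancel₀ (hd0 x' hx')] using this
      have h2 : (x - x') ⬝ᵥ w x' = 0 := by
        rw [sub_dotProduct, h1]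
        exact sub_self _
      rw [hd x' (x - x')] at h2
      obtain ⟨t, ht⟩ := exists_eq_smul_of_det_eq_zero _ _ (hdir0 x' hx') h2
      exact hX x hx x' hx' t (by rw [← ht]; abel)
    · rintro rfl
      exact inv_mul_cancel₀ (hd0 x hx)
  refine ⟨X.image Φ, card_image_of_injective _ hΦ, ?_, ?_⟩
  · intro f hf
    rw [mem_image] at hf
    obtain ⟨x, hx, rfl⟩ := hf
    exact hx
  · intro f hf f' hf'
    rw [mem_image] at hf hf'
    obtain ⟨x, hx, rfl⟩ := hf
    obtain ⟨x', hx', rfl⟩ := hf'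
    change x ⬝ᵥ ((d x')⁻¹ • w x') = 1 ↔ Φ x = Φ x'
    rw [key x hx x' hx']
    exact ⟨fun h => by rw [h], fun h => hΦ h⟩

/-- **Torus equivariance** (`k = 0`).  If `g` is injective on vectors and commutes with `J`, the
admissibility condition (ii) for the linear direction field `x ↦ J x` is transported from `X` to
`g X` (and so is (i)).  For `J` without eigenvectors over `𝔽_p` the invertible elements of
`𝔽_p[J] ≅ 𝔽_{p²}` act simply transitively on `𝔽_p² ∖ 0`, so admissible sets are exactly the
independent sets of a Cayley graph of the non-split torus.  [elementary] -/
theorem linearField_equivariant (J g : Matrix (Fin 2) (Fin 2) F) (hg : Function.Injective g.mulVec)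
    (hJg : J * g = g * J) (X : Finset (Fin 2 → F))
    (hJ : ∀ x ∈ X, ∀ t : F, J *ᵥ x ≠ t • x)
    (hX : ∀ x ∈ X, ∀ x' ∈ X, ∀ t : F, x = x' + t • (J *ᵥ x') → x = x') :
    (∀ y ∈ X.image g.mulVec, ∀ t : F, J *ᵥ y ≠ t • y) ∧
    (∀ y ∈ X.image g.mulVec, ∀ y' ∈ X.image g.mulVec, ∀ t : F,
      y = y' + t • (J *ᵥ y') → y = y') := by
  have hcomm : ∀ x : Fin 2 → F, J *ᵥ (g *ᵥ x) = g *ᵥ (J *ᵥ x) := by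
    intro x
    rw [mulVec_mulVec, mulVec_mulVec, hJg]
  constructor
  · intro y hy t h
    rw [mem_image] at hy
    obtain ⟨x, hx, rfl⟩ := hy
    apply hJ x hx t
    apply hg
    rw [← hcomm, mulVec_smul]
    exact h
  · intro y hy y' hy' t h
    rw [mem_image] at hy hy'
    obtain ⟨x, hx, rfl⟩ := hy
    obtain ⟨x', hx', rfl⟩ := hy'
    have hxx : x = x' + t • (J *ᵥ x') := by
      apply hg
      rw [mulVec_add, mulVec_smul, ← hcomm]
      exact h
    change g *ᵥ x = g *ᵥ x'
    rw [hX x hx x' hx' t hxx]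

end AffineField

section Stub

/-- **Residual of the equivariant-field family, in the stub's shape.**  If for some `c > 0` and
unboundedly many primes `p` there are `J ∈ M₂(𝔽_p)`, `k ∈ 𝔽_p²` and an admissible `X ⊆ 𝔽_p² ∖ 0`
(conditions (i), (ii) of `affineField_srs`) with `|X| ≥ c·p^{3/2}`, then `stub_tangencySets` holds —
with the same constant.  For `k = 0` and `J` irreducible this asks for independent sets of size
`c·p^{3/2}` in the torus circulants (Hoffman bound `≈ p^{3/2}`, i.e. near-Ramanujan-extremal
independent sets over a PRIME modulus); for `J` nilpotent, `k ≠ 0` it is the parabola-free-set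
residual of the parabola-lift axis.  [this file] -/
theorem stub_tangencySets_of_affineFields
    (h : ∃ c : ℝ, 0 < c ∧ ∀ p₀ : ℕ, ∃ (p : ℕ) (_ : Fact p.Prime), p₀ ≤ p ∧
      ∃ (J : Matrix (Fin 2) (Fin 2) (ZMod p)) (k : Fin 2 → ZMod p) (X : Finset (Fin 2 → ZMod p)),
        (0 : Fin 2 → ZMod p) ∉ X ∧ (∀ x ∈ X, ∀ t : ZMod p, J *ᵥ x + k ≠ t • x) ∧
        (∀ x ∈ X, ∀ x' ∈ X, ∀ t : ZMod p, x = x' + t • (J *ᵥ x' + k) → x = x') ∧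
        c * (p : ℝ) ^ (3 / 2 : ℝ) ≤ X.card) :
    ∃ c : ℝ, 0 < c ∧ ∀ p₀ : ℕ, ∃ (p : ℕ) (_ : Fact p.Prime), p₀ ≤ p ∧
      ∃ S : Finset ((Fin 2 → ZMod p) × (Fin 2 → ZMod p)),
        c * (p : ℝ) ^ (3 / 2 : ℝ) ≤ S.card ∧
        ∀ f ∈ S, ∀ f' ∈ S, (dotProduct f.1 f'.2 = 1 ↔ f = f') := by
  obtain ⟨c, hc, hfam⟩ := h
  refine ⟨c, hc, fun p₀ => ?_⟩
  obtain ⟨p, hp, hp₀, J, k, X, h0, hJ, hX, hbig⟩ := hfam p₀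
  obtain ⟨S, hcard, -, hS⟩ := affineField_srs J k X h0 hJ hX
  exact ⟨p, hp, hp₀, S, by rw [hcard]; exact hbig, hS⟩

end Stub

end Summit.MatrixMultiplication.MatrixMultiplication.Theorems.LevelOneGL2Designs.HermitianUnital
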